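import Summits.CriticalPhenomena.PercolationContinuityZ3.Theorems.PercNearOneGluingNoHeavyPcintNawMemoryFourExact
import HarnessLib

/-!
# CriticalPhenomena/PercolationContinuityZ3 — Theorems/PercNearOneGluingNoHeavyPcintNawMemorySixDeficit.lean: combinatorics for STRICT monotonicity of the SITE hierarchy at the second rung — the two-class recursion of memory-4 neighbour-avoiding words RESTRICTED to a set of prefixes, and the CHAIR-HEXAGON continuation (`d ≥ 3`)

Lane prim-pcint, STRUCTURE rule; site twin of …PcintMemorySixDeficit, lemma file for …PcintNawMemorySixStrict
(`μ^N_6(d) < μ^N_4(d)` for every `d ≥ 3`: `Δ^N_6 > 0`, `R^N_6 > 0`, the lower half of the typed site window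
`siteLoopCompatWindow` at the second rung).

* The memory-4 neighbour-avoiding words (`IsNAWFour`: no reversal, no U-turn; …PcintNawMemoryFour) split into the classes
  `S` (last two steps equal) and `T` (last two steps differ) with the UPPER recursion `S' ≤ S + T`,
  `T' ≤ (2d−2)S + (2d−3)T`; here RESTRICTED to the one-step extensions of an arbitrary set of prefixes
  (`card_nawFourS_succ_filter_le`, `card_nawFourT_succ_filter_le`), with the partition `card_filter_nawFourST`.
* **`chair_continuation`** (`d ≥ 3`): `w ↦ w · r e₁ e₂ r⁻ e₁⁻ e₂⁻` (`r` the last step of `w`; `e₁, e₂` on two further axes)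
  is injective, keeps `IsNAWFour`, ends in class `T`, and returns to the end of `w` after six steps — so it is NOT a word of
  neighbour-avoidance memory `6` (the chair hexagon is the chordless hexagon of `ℤ^d`, `d ≥ 3`; `ℤ²` has none, and indeed
  the site law is typed for `d ≥ 3`).

HONEST FRAMING: elementary combinatorics; nothing here is used by a certified `p_c` cell.  Written by prim-pcint-2 gen 17
(prover-prim-pcint-2-g17-0), 2026-08-25.
-/

noncomputable section

open Filter Topology
open Literature.Probability.LatticeModels Literature.Probability.Percolation
open Summit.CriticalPhenomena.PercolationContinuityZ3.Theorems.Pcint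

namespace Summit.CriticalPhenomena.PercolationContinuityZ3.Theorems.Pcint.NawTail

variable {d : ℕ}

/-! ### The two-class partition of a set of memory-4 neighbour-avoiding words -/

/-- `#S = #(S ∩ S-class) + #(S ∩ T-class)` for any set of words of length `n + 2` inside `nawFourWords`. [folklore] -/
theorem card_filter_nawFourST {n : ℕ} (S : Finset (Fin (n + 2) → Fin d × Bool)) (hS : S ⊆ nawFourWords d (n + 2)) :
    (S.filter fun w => w ∈ nawFourS d n).card + (S.filter fun w => w ∈ nawFourT d n).card = S.card := by
  classical
  have h1 : (S.filter fun w => w ∈ nawFourS d n) = S.filter fun w => w ⟨n + 1, by omega⟩ = w ⟨n, by omega⟩ := by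
    ext w
    simp only [Finset.mem_filter, nawFourS, and_congr_right_iff]
    exact fun hw => ⟨fun h => h.2, fun h => ⟨hS hw, h⟩⟩
  have h2 : (S.filter fun w => w ∈ nawFourT d n) = S.filter fun w => ¬ w ⟨n + 1, by omega⟩ = w ⟨n, by omega⟩ := by
    ext w
    simp only [Finset.mem_filter, nawFourT, and_congr_right_iff]
    exact fun hw => ⟨fun h => h.2, fun h => ⟨hS hw, h⟩⟩
  rw [h1, h2, Finset.card_filter_add_card_filter_not]

/-! ### The two-class upper recursion restricted to a set of prefixes -/

/-- **`S`-extensions of `S₀` number at most `#S₀`** (the last step repeats the previous one). [folklore] -/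
theorem card_nawFourS_succ_filter_le {n : ℕ} (S : Finset (Fin (n + 2) → Fin d × Bool)) :
    ((nawFourS d (n + 1)).filter fun w => wordInit' w ∈ S).card ≤ S.card := by
  classical
  refine Finset.card_le_card_of_injOn (fun w => wordInit' w) (fun w hw => ?_) (fun w hw w' hw' h => ?_)
  · rw [Finset.mem_coe, Finset.mem_filter] at hw
    exact hw.2
  · rw [Finset.mem_coe, Finset.mem_filter, nawFourS, Finset.mem_filter] at hw hw'
    apply wordInit'_last_injective (n + 2)
    refine Prod.ext h ?_
    show w ⟨n + 2, _⟩ = w' ⟨n + 2, _⟩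
    rw [hw.1.2, hw'.1.2]
    have := congrFun h ⟨n + 1, by omega⟩
    simpa [wordInit'] using this

/-- **`T`-extensions of `S₀` number at most `(2d−2)·#(S₀ ∩ S) + (2d−3)·#(S₀ ∩ T)`** (the `nextT`-admissible steps).
[folklore] -/
theorem card_nawFourT_succ_filter_le {n : ℕ} (S : Finset (Fin (n + 2) → Fin d × Bool))
    (hS : S ⊆ nawFourWords d (n + 2)) :
    ((nawFourT d (n + 1)).filter fun w => wordInit' w ∈ S).card ≤
      (2 * d - 2) * (S.filter fun u => u ∈ nawFourS d n).card + (2 * d - 3) * (S.filter fun u => u ∈ nawFourT d n).card := by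
  classical
  set F : (Fin (n + 3) → Fin d × Bool) → (Σ _ : Fin (n + 2) → Fin d × Bool, Fin d × Bool) :=
    fun w => ⟨wordInit' w, w ⟨n + 2, by omega⟩⟩ with hF
  set Tg := S.sigma fun u => nextT (u ⟨n, by omega⟩) (u ⟨n + 1, by omega⟩) with hTg
  have hmaps : Set.MapsTo F (((nawFourT d (n + 1)).filter fun w => wordInit' w ∈ S) : Set _) (Tg : Set _) := by
    intro w hw
    rw [Finset.mem_coe, Finset.mem_filter, nawFourT, Finset.mem_filter, mem_nawFourWords] at hw
    obtain ⟨⟨hw4, hne⟩, hwS⟩ := hw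
    rw [Finset.mem_coe, hTg, Finset.mem_sigma]
    refine ⟨hwS, ?_⟩
    rw [nextT, Finset.mem_filter]
    simp only [hF, wordInit']
    exact ⟨Finset.mem_univ _, hne, hw4.1 (n + 1) (by omega), hw4.2 n (by omega)⟩
  have hinj : Set.InjOn F (((nawFourT d (n + 1)).filter fun w => wordInit' w ∈ S) : Set _) := by
    intro w _ w' _ h
    simp only [hF, Sigma.mk.injEq, heq_eq_eq] at h
    exact wordInit'_last_injective (n + 2) (Prod.ext h.1 h.2)
  have hS' : (S.filter fun u => u ⟨n + 1, by omega⟩ = u ⟨n, by omega⟩) = S.filter fun u => u ∈ nawFourS d n := by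
    ext u
    simp only [Finset.mem_filter, nawFourS, and_congr_right_iff]
    exact fun hu => ⟨fun h => ⟨hS hu, h⟩, fun h => h.2⟩
  have hT' : (S.filter fun u => ¬ u ⟨n + 1, by omega⟩ = u ⟨n, by omega⟩) = S.filter fun u => u ∈ nawFourT d n := by
    ext u
    simp only [Finset.mem_filter, nawFourT, and_congr_right_iff]
    exact fun hu => ⟨fun h => ⟨hS hu, h⟩, fun h => h.2⟩
  calc ((nawFourT d (n + 1)).filter fun w => wordInit' w ∈ S).card ≤ Tg.card := Finset.card_le_card_of_injOn F hmaps hinj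
    _ = ∑ u ∈ S, (nextT (u ⟨n, by omega⟩) (u ⟨n + 1, by omega⟩)).card := Finset.card_sigma _ _
    _ ≤ ∑ u ∈ S, (if u ⟨n, by omega⟩ = u ⟨n + 1, by omega⟩ then 2 * d - 2 else 2 * d - 3) :=
        Finset.sum_le_sum fun u hu => card_nextT_le _ _ ((mem_nawFourWords.1 (hS hu)).1 n (by omega))
    _ = (2 * d - 2) * (S.filter fun u => u ∈ nawFourS d n).card +
          (2 * d - 3) * (S.filter fun u => u ∈ nawFourT d n).card := by
        rw [← Finset.sum_filter_add_sum_filter_not S (fun u => u ⟨n + 1, by omega⟩ = u ⟨n, by omega⟩)]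
        have h1 : ∀ u ∈ S.filter (fun u => u ⟨n + 1, by omega⟩ = u ⟨n, by omega⟩),
            (if u ⟨n, by omega⟩ = u ⟨n + 1, by omega⟩ then 2 * d - 2 else 2 * d - 3) = 2 * d - 2 := by
          intro u hu
          rw [Finset.mem_filter] at hu
          rw [if_pos hu.2.symm]
        have h2 : ∀ u ∈ S.filter (fun u => ¬ u ⟨n + 1, by omega⟩ = u ⟨n, by omega⟩),
            (if u ⟨n, by omega⟩ = u ⟨n + 1, by omega⟩ then 2 * d - 2 else 2 * d - 3) = 2 * d - 3 := by
          intro u hu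
          rw [Finset.mem_filter] at hu
          rw [if_neg (fun h => hu.2 h.symm)]
        rw [Finset.sum_congr rfl h1, Finset.sum_congr rfl h2, Finset.sum_const, Finset.sum_const, smul_eq_mul, smul_eq_mul,
          hS', hT', mul_comm (S.filter fun u => u ∈ nawFourS d n).card, mul_comm (S.filter fun u => u ∈ nawFourT d n).card]

/-! ### The chair-hexagon continuation -/

/-- The prefix `wordInit'` of a word with neighbour-avoidance memory `τ` has memory `τ`. [folklore] -/
theorem isNawMem_wordInit' {τ n : ℕ} {w : Fin (n + 1) → Fin d × Bool} (h : IsNawMem τ w) : IsNawMem τ (wordInit' w) := by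
  intro i j hj hij hτ
  have e : ∀ k, k ≤ n → wordPos (wordInit' w) k = wordPos w k := fun k hk =>
    Literature.Probability.FitznerVanDerHofstad2017.wordPos_wordInit w hk
  rw [e i (by omega), e j hj]
  exact h i j (by omega) hij hτ

/-- **The chair-hexagon continuation.**  For `d ≥ 3` there is a map `c` sending each word `w` of length `n + 2` (last step
`r`; `e₁, e₂` on two further distinct axes) to `w · r e₁ e₂ r⁻ e₁⁻ e₂⁻` (length `n + 8`) such that: `c` is injective and `w`
is the prefix of `c w`; `IsNAWFour` is preserved (the six appended steps contain neither a reversal nor a U-turn); `c w` ends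
with two different steps (class `T`); and `c w` does NOT have neighbour-avoidance memory `6` — its sites at times `n + 2` and
`n + 8` coincide (the chair hexagon `r e₁ e₂ r⁻ e₁⁻ e₂⁻`). [folklore] -/
theorem chair_continuation (hd : 3 ≤ d) (n : ℕ) :
    ∃ c : (Fin (n + 2) → Fin d × Bool) → (Fin (n + 8) → Fin d × Bool),
      Function.Injective c ∧
      (∀ w (i : Fin (n + 2)), c w ⟨i.1, by omega⟩ = w i) ∧
      (∀ w, IsNAWFour w → IsNAWFour (c w)) ∧
      (∀ w, c w ⟨n + 7, by omega⟩ ≠ c w ⟨n + 6, by omega⟩) ∧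
      (∀ w, ¬ IsNawMem 6 (c w)) := by
  classical
  -- two further axes (values `(v+1) % 3`, `(v+2) % 3` for the axis `v` of `r`; needs `d ≥ 3`)
  let ax1 : Fin d × Bool → Fin d × Bool := fun r =>
    (⟨(r.1.val + 1) % 3, by have := Nat.mod_lt (r.1.val + 1) (by norm_num : 0 < 3); omega⟩, true)
  let ax2 : Fin d × Bool → Fin d × Bool := fun r =>
    (⟨(r.1.val + 2) % 3, by have := Nat.mod_lt (r.1.val + 2) (by norm_num : 0 < 3); omega⟩, true)
  have hax1 : ∀ r, (ax1 r).1 ≠ r.1 := fun r e => by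
    have := congrArg Fin.val e; simp only [ax1] at this; omega
  have hax2 : ∀ r, (ax2 r).1 ≠ r.1 := fun r e => by
    have := congrArg Fin.val e; simp only [ax2] at this; omega
  have hax12 : ∀ r, (ax2 r).1 ≠ (ax1 r).1 := fun r e => by
    have := congrArg Fin.val e; simp only [ax1, ax2] at this; omega
  -- the continuation, letter by letter
  let c : (Fin (n + 2) → Fin d × Bool) → (Fin (n + 8) → Fin d × Bool) := fun w i =>
    if h : i.1 < n + 2 then w ⟨i.1, h⟩
    else if i.1 = n + 2 then w ⟨n + 1, by omega⟩
    else if i.1 = n + 3 then ax1 (w ⟨n + 1, by omega⟩)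
    else if i.1 = n + 4 then ax2 (w ⟨n + 1, by omega⟩)
    else if i.1 = n + 5 then srev (w ⟨n + 1, by omega⟩)
    else if i.1 = n + 6 then srev (ax1 (w ⟨n + 1, by omega⟩))
    else srev (ax2 (w ⟨n + 1, by omega⟩))
  have c_lt : ∀ w (i : ℕ) (hi : i < n + 2), c w ⟨i, by omega⟩ = w ⟨i, hi⟩ := fun w i hi => by simp [c, hi]
  have c_2 : ∀ w (i : ℕ) (hi : i < n + 8), i = n + 2 → c w ⟨i, hi⟩ = w ⟨n + 1, by omega⟩ := fun w i hi h => by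
    simp [c, h]
  have c_3 : ∀ w (i : ℕ) (hi : i < n + 8), i = n + 3 → c w ⟨i, hi⟩ = ax1 (w ⟨n + 1, by omega⟩) := fun w i hi h => by
    simp [c, h]
  have c_4 : ∀ w (i : ℕ) (hi : i < n + 8), i = n + 4 → c w ⟨i, hi⟩ = ax2 (w ⟨n + 1, by omega⟩) := fun w i hi h => by
    simp [c, h]
  have c_5 : ∀ w (i : ℕ) (hi : i < n + 8), i = n + 5 → c w ⟨i, hi⟩ = srev (w ⟨n + 1, by omega⟩) := fun w i hi h => by
    simp [c, h]
  have c_6 : ∀ w (i : ℕ) (hi : i < n + 8), i = n + 6 → c w ⟨i, hi⟩ = srev (ax1 (w ⟨n + 1, by omega⟩)) :=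
    fun w i hi h => by simp [c, h]
  have c_7 : ∀ w (i : ℕ) (hi : i < n + 8), i = n + 7 → c w ⟨i, hi⟩ = srev (ax2 (w ⟨n + 1, by omega⟩)) :=
    fun w i hi h => by
      simp [c, show ¬ (i < n + 2) by omega, show i ≠ n + 2 by omega, show i ≠ n + 3 by omega, show i ≠ n + 4 by omega,
        show i ≠ n + 5 by omega, show i ≠ n + 6 by omega]
  refine ⟨c, ?_, fun w i => c_lt w i.1 i.2, ?_, ?_, ?_⟩
  · intro w w' h
    funext i
    rw [← c_lt w i.1 i.2, ← c_lt w' i.1 i.2, h]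
  · -- IsNAWFour is kept
    intro w hw
    set r := w ⟨n + 1, by omega⟩ with hr
    set a := ax1 r with ha
    set b := ax2 r with hb
    have ha1 : a.1 ≠ r.1 := hax1 r
    have hb1 : b.1 ≠ r.1 := hax2 r
    have hba : b.1 ≠ a.1 := hax12 r
    -- the facts used below: distinct axes exclude equality with reverses
    have ne1 : a ≠ srev r := (srev_ne_of_fst_ne ha1.symm).symm
    have ne2 : b ≠ srev a := (srev_ne_of_fst_ne hba.symm).symm
    have ne3 : b ≠ srev r := (srev_ne_of_fst_ne hb1.symm).symm
    have ne4 : srev r ≠ srev b := fun e => hb1 (congrArg Prod.fst (srev_injective e)).symm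
    have ne5 : srev r ≠ srev a := fun e => ha1 (congrArg Prod.fst (srev_injective e)).symm
    have ne6 : srev a ≠ srev (srev r) := by rw [srev_srev]; exact srev_ne_of_fst_ne ha1
    have ne7 : srev a ≠ srev b := fun e => hba (congrArg Prod.fst (srev_injective e)).symm
    have ne8 : srev b ≠ srev (srev a) := by rw [srev_srev]; exact srev_ne_of_fst_ne hba
    have ne9 : srev b ≠ srev (srev r) := by rw [srev_srev]; exact srev_ne_of_fst_ne hb1
    refine ⟨fun k hk => ?_, fun k hk => ?_⟩
    · -- no reversal at positions k, k+1
      by_cases h1 : k + 1 < n + 2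
      · rw [c_lt w (k + 1) h1, c_lt w k (by omega)]; exact hw.1 k h1
      rcases (show k = n + 1 ∨ k = n + 2 ∨ k = n + 3 ∨ k = n + 4 ∨ k = n + 5 ∨ k = n + 6 by omega)
        with rfl | rfl | rfl | rfl | rfl | rfl
      · rw [c_2 w (n + 1 + 1) hk (by omega), c_lt w (n + 1) (by omega)]; exact (srev_ne_self _).symm
      · rw [c_3 w (n + 2 + 1) hk (by omega), c_2 w (n + 2) (by omega) rfl]; exact ne1
      · rw [c_4 w (n + 3 + 1) hk (by omega), c_3 w (n + 3) (by omega) rfl]; exact ne2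
      · rw [c_5 w (n + 4 + 1) hk (by omega), c_4 w (n + 4) (by omega) rfl]; exact ne4
      · rw [c_6 w (n + 5 + 1) hk (by omega), c_5 w (n + 5) (by omega) rfl]; exact ne6
      · rw [c_7 w (n + 6 + 1) hk (by omega), c_6 w (n + 6) (by omega) rfl]; exact ne8
    · -- no U-turn at positions k, k+2
      by_cases h2 : k + 2 < n + 2
      · rw [c_lt w (k + 2) h2, c_lt w k (by omega)]; exact hw.2 k h2
      rcases (show k = n ∨ k = n + 1 ∨ k = n + 2 ∨ k = n + 3 ∨ k = n + 4 ∨ k = n + 5 by omega)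
        with rfl | rfl | rfl | rfl | rfl | rfl
      · rw [c_2 w (k + 2) hk (by omega), c_lt w k (by omega)]
        -- `r ≠ srev (w k)`: else `w` reverses at its last step
        exact hw.1 k (by omega)
      · rw [c_3 w (n + 1 + 2) hk (by omega), c_lt w (n + 1) (by omega)]; exact ne1
      · rw [c_4 w (n + 2 + 2) hk (by omega), c_2 w (n + 2) (by omega) rfl]; exact ne3
      · rw [c_5 w (n + 3 + 2) hk (by omega), c_3 w (n + 3) (by omega) rfl]; exact ne5
      · rw [c_6 w (n + 4 + 2) hk (by omega), c_4 w (n + 4) (by omega) rfl]; exact ne7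
      · rw [c_7 w (n + 5 + 2) hk (by omega), c_5 w (n + 5) (by omega) rfl]; exact ne9
  · -- the continuation ends in class T
    intro w h
    rw [c_7 w (n + 7) (by omega) rfl, c_6 w (n + 6) (by omega) rfl] at h
    exact hax12 (w ⟨n + 1, by omega⟩) (congrArg Prod.fst (srev_injective h))
  · -- the return at gap six
    intro w h6
    have hpre : ∀ k, k ≤ n + 2 → wordPos (c w) k = wordPos w k := by
      intro k hk
      induction k with
      | zero => simp
      | succ k ih =>
        rw [wordPos_succ (c w) (by omega : k < n + 8), wordPos_succ w (by omega : k < n + 2), ih (by omega),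
          c_lt w k (by omega)]
    have e3 : wordPos (c w) (n + 3) = wordPos (c w) (n + 2) + stepVec (c w ⟨n + 2, by omega⟩) :=
      wordPos_succ (c w) (by omega)
    have e4 : wordPos (c w) (n + 4) = wordPos (c w) (n + 3) + stepVec (c w ⟨n + 3, by omega⟩) :=
      wordPos_succ (c w) (by omega)
    have e5 : wordPos (c w) (n + 5) = wordPos (c w) (n + 4) + stepVec (c w ⟨n + 4, by omega⟩) :=
      wordPos_succ (c w) (by omega)
    have e6 : wordPos (c w) (n + 6) = wordPos (c w) (n + 5) + stepVec (c w ⟨n + 5, by omega⟩) :=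
      wordPos_succ (c w) (by omega)
    have e7 : wordPos (c w) (n + 7) = wordPos (c w) (n + 6) + stepVec (c w ⟨n + 6, by omega⟩) :=
      wordPos_succ (c w) (by omega)
    have e8 : wordPos (c w) (n + 8) = wordPos (c w) (n + 7) + stepVec (c w ⟨n + 7, by omega⟩) :=
      wordPos_succ (c w) (by omega)
    have h8 : wordPos (c w) (n + 8) = wordPos (c w) (n + 2) := by
      rw [e8, e7, e6, e5, e4, e3, c_2 w (n + 2) (by omega) rfl, c_3 w (n + 3) (by omega) rfl,
        c_4 w (n + 4) (by omega) rfl, c_5 w (n + 5) (by omega) rfl, c_6 w (n + 6) (by omega) rfl,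
        c_7 w (n + 7) (by omega) rfl, stepVec_srev, stepVec_srev, stepVec_srev]
      abel
    exact (h6 (n + 2) (n + 8) le_rfl (by omega) (by omega)).1 h8.symm

end Summit.CriticalPhenomena.PercolationContinuityZ3.Theorems.Pcint.NawTail
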